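import Summits.RiemannHypothesis.RiemannHypothesis.Theses.IntegerScrew
import HarnessLib

/-!
# Route IntegerScrew — `FloorOfRH` (stmt-RiemannHypothesis-15762) / crux `ScrewPolyFloor`
(stmt-RiemannHypothesis-15757), line `weil_comb_floor`: stub S6 `stub_endgameComb`

The parameter choice `ε = M^{−K}` of the Weil-comb floor argument (pure real analysis).  Given the
constant `C` of WeilComb's `analyticReduction` and `N = ‖φ‖₂² > 0`, `B = ‖φ'‖₁'² > 0`, choose
`K ≥ 4` with `(K − 2) log 2 ≥ C + 4`.  For `M ≥ 2`, `P = M^K`: `8M/P ≤ 1` (`P ≥ M⁴ ≥ 8M`),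
`12M²/P ≤ 3` (`P ≥ 4M²`), `log(1/P⁻¹) = K log M`, so the bracket
`K log M − C − (log M + 1) − 12M²/P ≥ (K − 1) log 2 − C − 4 ≥ log 2`; hence with `A = K`,
`c = (N/B) log 2`: `c M^{−A} = (N/B) log 2 · P⁻¹ ≤ P⁻¹ (N/B) · bracket`.
-/

-- `Summit.RiemannHypothesis.RiemannHypothesis.…` duplicates `RiemannHypothesis` BY DESIGN (D-0017).
set_option linter.dupNamespace false

noncomputable section

namespace Summit.RiemannHypothesis.RiemannHypothesis.Theorems

/-- **Stub S6 `stub_endgameComb`** of line `weil_comb_floor` (crux `ScrewPolyFloor`; serves the route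
item `FloorOfRH`): for all real `C` and `N, B > 0` there are `K : ℕ`, `A`, `c > 0` (namely `A = K`,
`c = (N/B) log 2`, any `K ≥ 4` with `(K−2) log 2 ≥ C + 4`) such that for every `M ≥ 2`:
`8 (M^K)⁻¹ M ≤ 1` and
`c M^{−A} ≤ (M^K)⁻¹ N/B · (log(1/(M^K)⁻¹) − C − (log M + 1) − (M^K)⁻¹ (12 M²))`. -/
theorem IntegerScrew.stub_endgameComb_proof :
    ∀ (C N B : ℝ), 0 < N → 0 < B → ∃ (K : ℕ) (A c : ℝ), 0 < c ∧ ∀ M : ℕ, 2 ≤ M →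
      8 * ((M : ℝ) ^ K)⁻¹ * M ≤ 1 ∧
        c * (M : ℝ) ^ (-A) ≤
          ((M : ℝ) ^ K)⁻¹ * N / B *
            (Real.log (1 / ((M : ℝ) ^ K)⁻¹) - C - (Real.log M + 1) -
              ((M : ℝ) ^ K)⁻¹ * (12 * (M : ℝ) ^ 2)) := by
  intro C N B hN hB
  have hlog2 : (2 : ℝ) / 3 ≤ Real.log 2 := by
    have := Real.log_two_gt_d9
    linarith
  have hlog2pos : 0 < Real.log 2 := by linarith
  -- choice of `K`
  obtain ⟨K, hK⟩ := exists_nat_ge (max 4 ((C + 4) / Real.log 2 + 2))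
  have hK4r : (4 : ℝ) ≤ K := le_trans (le_max_left _ _) hK
  have hK4 : 4 ≤ K := by exact_mod_cast hK4r
  have hKC : (C + 4) / Real.log 2 + 2 ≤ K := le_trans (le_max_right _ _) hK
  have hKC' : C + 4 ≤ ((K : ℝ) - 2) * Real.log 2 := by
    have h1 : (C + 4) / Real.log 2 ≤ (K : ℝ) - 2 := by linarith
    rwa [div_le_iff₀ hlog2pos] at h1
  refine ⟨K, K, N / B * Real.log 2, by positivity, fun M hM => ?_⟩
  have hM2 : (2 : ℝ) ≤ M := by exact_mod_cast hM
  have hMpos : (0 : ℝ) < M := by linarith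
  -- notation `P = M^K`, `ℓ = log M`
  set P : ℝ := (M : ℝ) ^ K with hP
  set ℓ : ℝ := Real.log M with hℓ
  have hPpos : 0 < P := by positivity
  have hℓ2 : Real.log 2 ≤ ℓ := Real.log_le_log (by norm_num) hM2
  -- `P = M^(K-4) * M^4 ≥ M^4`
  obtain ⟨j, hj⟩ : ∃ j, K = j + 4 := ⟨K - 4, by omega⟩
  have hMj : (1 : ℝ) ≤ (M : ℝ) ^ j := one_le_pow₀ (by linarith)
  have hP4 : (M : ℝ) ^ 4 ≤ P := by
    rw [hP, hj, pow_add]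
    have := mul_le_mul_of_nonneg_right hMj (by positivity : (0 : ℝ) ≤ (M : ℝ) ^ 4)
    linarith
  have hM3 : (8 : ℝ) ≤ (M : ℝ) ^ 3 := by
    have := pow_le_pow_left₀ (by norm_num : (0 : ℝ) ≤ 2) hM2 3
    norm_num at this
    exact this
  have hMsq4 : (4 : ℝ) ≤ (M : ℝ) ^ 2 := by nlinarith
  -- (i) `8 M ≤ P`
  have h8 : 8 * (M : ℝ) ≤ P := by
    have e : (M : ℝ) ^ 4 = (M : ℝ) ^ 3 * M := by ring
    have : 8 * (M : ℝ) ≤ (M : ℝ) ^ 3 * M := by nlinarith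
    linarith
  have hi : 8 * P⁻¹ * (M : ℝ) ≤ 1 := by
    rw [show 8 * P⁻¹ * (M : ℝ) = (8 * M) / P by ring, div_le_one hPpos]
    exact h8
  -- (ii) `12 M² / P ≤ 3`
  have h4sq : 4 * (M : ℝ) ^ 2 ≤ P := by
    have e : (M : ℝ) ^ 4 = (M : ℝ) ^ 2 * (M : ℝ) ^ 2 := by ring
    have : 4 * (M : ℝ) ^ 2 ≤ (M : ℝ) ^ 2 * (M : ℝ) ^ 2 :=
      mul_le_mul_of_nonneg_right hMsq4 (by positivity)
    linarith
  have hii : P⁻¹ * (12 * (M : ℝ) ^ 2) ≤ 3 := by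
    rw [show P⁻¹ * (12 * (M : ℝ) ^ 2) = (12 * (M : ℝ) ^ 2) / P by ring, div_le_iff₀ hPpos]
    linarith
  -- (iii) the bracket is `≥ log 2`
  have hlogP : Real.log (1 / P⁻¹) = K * ℓ := by
    rw [one_div, inv_inv, hP, Real.log_pow]
  have hbr : Real.log 2 ≤ K * ℓ - C - (ℓ + 1) - P⁻¹ * (12 * (M : ℝ) ^ 2) := by
    have hK1 : (0 : ℝ) ≤ (K : ℝ) - 1 := by linarith
    have h1 : ((K : ℝ) - 1) * Real.log 2 ≤ ((K : ℝ) - 1) * ℓ :=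
      mul_le_mul_of_nonneg_left hℓ2 hK1
    nlinarith
  -- (iv) assemble
  have hrpow : (M : ℝ) ^ (-(K : ℝ)) = P⁻¹ := by
    rw [Real.rpow_neg hMpos.le, Real.rpow_natCast]
  refine ⟨hi, ?_⟩
  rw [hrpow, hlogP]
  have hfac : 0 ≤ P⁻¹ * N / B := by positivity
  calc N / B * Real.log 2 * P⁻¹ = P⁻¹ * N / B * Real.log 2 := by ring
    _ ≤ P⁻¹ * N / B * (K * ℓ - C - (ℓ + 1) - P⁻¹ * (12 * (M : ℝ) ^ 2)) :=
        mul_le_mul_of_nonneg_left hbr hfac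

end Summit.RiemannHypothesis.RiemannHypothesis.Theorems

end
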